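import Mathlib.LinearAlgebra.Matrix.PosDef
import Mathlib.LinearAlgebra.Matrix.Symmetric
import Mathlib.LinearAlgebra.Matrix.ToLin
import Mathlib.LinearAlgebra.Matrix.NonsingularInverse
import Mathlib.Analysis.Real.Sqrt
import Mathlib.LinearAlgebra.Matrix.Notation
import HarnessLib

/-!
# The symmetric Kronecker product and the `svec` calculus of primal–dual SDP methods
# (Antoniou–Lu 2007, §14.4.1–§14.4.3, (14.32)–(14.43), Lemma 14.1; §A.15 (A.75)–(A.76);
# Problems 14.6, 14.7(b), 14.8–14.11)

Source: A. Antoniou, W.-S. Lu, *Practical Optimization: Algorithms and Engineering Applications*,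
Springer (2007) [AntoniouLu2007], §14.4 *Primal–dual path-following method* (§14.4.1
reformulation of the centering condition, §14.4.2 *Symmetric Kronecker product*, §14.4.3
*Reformulation of Eq. (14.34)*), Appendix A.15 *Vector spaces of symmetric matrices*, and
Problems 14.6–14.11 (held copy read; section / equation / problem numbers are cited, not pages).
The construction is the one of Alizadeh–Haeberly–Overton (the book's reference [8] of Ch. 14).

Setting. `𝒮ⁿ` = real symmetric `n × n` matrices with `A • B = trace (A B)` ((A.75)). The centering
condition `X S = τ I` of the central path is replaced by its symmetrisation `X S + S X = 2τ I`
((14.32)); the Newton step solves `X ΔS + ΔS X + ΔX S + S ΔX = 2τI − XS − SX` ((14.34c)) in the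
symmetric unknowns `ΔX, ΔS`. The operator `svec` ((14.37)) lists the upper triangle of
`K ∈ 𝒮ⁿ` with off-diagonal entries scaled by `√2`, so that `A • B = svec(A)ᵀ svec(B)` ((14.38)),
and the symmetric Kronecker product `M ⊛ N` (the book writes `M ⊙ N`) is the `n(n+1)/2`-square
matrix defined by `(M ⊛ N) svec(K) = svec(½ (N K Mᵀ + M K Nᵀ))` for all `K ∈ 𝒮ⁿ` ((14.36)). We
index `svec` by the type `UIdx n = {(i, j) // i ≤ j}` of upper-triangular positions of a linearly
ordered index type.

* `svec`, `smat` (the book's `mat = svec⁻¹`; `smat_apply_same`, `smat_apply_of_lt`,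
  `smat_apply_of_gt`, `isSymm_smat`), `smat_svec`, `svec_smat`, `svec_injective`, `svec_inj`,
  `svec_add`, `svec_smul`, `svec_zero`, `svec_sub`, `smat_add`, `smat_smul`.
* (14.38) / Problem 14.7(b), (A.75)–(A.76): `svec_dotProduct_svec` — `svec A ⬝ svec B = tr(AB)`
  for symmetric `A, B`; `svec_dotProduct_self` — `‖svec A‖² = Σᵢⱼ aᵢⱼ² = ‖A‖_F²`.
* (14.36) and Problem 14.8: `skronLin`, `skron M N` (the matrix of
  `v ↦ svec(½ (N mat(v) Mᵀ + M mat(v) Nᵀ))`; `skron_apply` — its `q`-th column is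
  `svec(½ (N E_q Mᵀ + M E_q Nᵀ))` with `E_q = mat(e_q)`), `skron_mulVec`, `skron_mulVec_svec`
  (the defining identity (14.36)), `eq_skron` (uniqueness: (14.36) determines `M ⊛ N`),
  `skron_comm` (`M ⊛ N = N ⊛ M`), `isSymm_symm_term`, `dotProduct_skron_mulVec`
  (`uᵀ (M ⊛ N) v = tr(U N V Mᵀ)`), `skron_transpose` (`(M ⊛ N)ᵀ = Mᵀ ⊛ Nᵀ`), `isSymm_skron`,
  `skron_one_one`, `skron_one_mulVec_svec` (`(M ⊛ I) svec K = svec(½ (K Mᵀ + M K))`).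
* Lemma 14.1 / Problem 14.9 (eigen-structure): `skron_mulVec_svec_eigenpair` — if `v, w` are
  common eigenvectors, `M v = α v, M w = α' w, N v = β v, N w = β' w`, then
  `svec(v wᵀ + w vᵀ)` is an eigenvector of `M ⊛ N` with eigenvalue `½ (α β' + β α')` (no
  symmetry or commutation hypothesis is needed for this direction); `skron_mulVec_svec_eigen_self`
  (`i = j`: eigenvalue `α β`); the Gram identities `svec_symm_dotProduct_svec_symm`,
  `svec_self_dotProduct_svec_self`, `svec_self_dotProduct_svec_symm` from which orthonormality
  of the listed eigenvectors for an orthonormal family `vᵢ` is read off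
  (`eigvec_norm_sq`, `eigvec_offDiag_norm_sq`, `eigvec_orthogonal`).
* §14.4.3 (14.39): `newton_centering_iff_svec` — for symmetric `X, S, ΔX, ΔS`, (14.34c) holds iff
  `(X ⊛ I) svec(ΔS) + (S ⊛ I) svec(ΔX) = svec(τ I − ½ (XS + SX))`.
* (14.42)–(14.43) / Problem 14.11: `newton_system_iff` — with `E` invertible, the block system
  `Aᵀ Δy + Δs = r_d, A Δx = r_p, E Δx + F Δs = r_c` is equivalent to (14.43a)–(14.43c) with the
  Schur complement `M = A E⁻¹ F Aᵀ` (stated over any commutative ring and index types).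
* Problem 14.6: `mul_eq_smul_one_iff_of_posDef_left` / `_right` — if `X ≻ 0` (or `S ≻ 0`) then
  `X S = τ I ⇔ X S + S X = 2τ I`; the key step `eq_zero_of_posDef_of_mul_add_mul_eq_zero`
  (`X ≻ 0, X T + T X = 0 ⇒ T = 0`); and Problem 14.6(b) `exists_symm_pair_not_equiv` — without
  definiteness the two conditions differ (`X = diag(1, −1)`, `S = [[0, 1], [1, 0]]`).
* Problem 14.10: `lyapunov_solution_of_common_eigenbasis` — if `Vᵀ V = I`, `M V = V diag(α)`,
  `N V = V diag(β)` and `C ∘ (αᵢβⱼ + βᵢαⱼ) = Vᵀ B V` entrywise, then `X = V C Vᵀ` solves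
  `M X Nᵀ + N X Mᵀ = B`.

RELATION TO THE TREE. Mathlib's `Matrix.vec` / `Matrix.kronecker_mulVec_vec`
(`(B ⊗ₖ A) *ᵥ vec X = vec (A X Bᵀ)`) is exactly the `nvec` identity (14.35) = (A.70) of the
ordinary Kronecker product (Problem 14.7(a)), and (A.75) `tr(AB) = Σᵢⱼ aᵢⱼ bᵢⱼ` is the tree's
`Literature.Combinatorics.SimpleGraph.LovaszThetaDual.trace_mul_eq_sum_of_transpose`; neither is
restated (the latter is re-derived inline where needed, that module is not imported). The general
Lyapunov / Sylvester solvability theory (`Literature.LinearAlgebra.Matrix.LyapunovEquation`,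
`…SylvesterEquation`, complex matrices with spectral hypotheses) is neither imported nor restated;
Problem 14.6 is the elementary real positive-definite case with its own two-line trace proof.
`Literature.Analysis.Convex.SemidefiniteStepLength` formalises Step 5 of the same Algorithm 14.1
(§14.4.4); this file supplies the linear algebra of its Step 4.

NOT formalised: the converse half of Lemma 14.1 (that these are *all* the eigenpairs, a counting /
spectral-theorem statement), "`J` nonsingular iff `M` nonsingular" and Monteiro's sufficient
condition `XS + SX ≻ 0` [12], Algorithm 14.1 itself and its convergence, Example 14.2, the MATLAB
Problem 14.8(b), §A.14 Example (A.72)–(A.74).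
-/

noncomputable section

namespace Literature.Analysis.Convex.SymmetricKroneckerProduct

open _root_.Matrix Finset

/-! ## Symmetric terms over a general index type -/

section General

variable {m : Type*} [Fintype m]

/-- `½ (N K Mᵀ + M K Nᵀ)` is symmetric when `K` is ("a symmetric term given by
`(N K Mᵀ + M K Nᵀ)/2` where `K ∈ 𝒮ⁿ`"). [cite: AntoniouLu2007, §14.4.2 (text before (14.36))] -/
theorem isSymm_symm_term (M N : Matrix m m ℝ) {K : Matrix m m ℝ} (hK : K.IsSymm) :
    ((1 / 2 : ℝ) • (N * K * Mᵀ + M * K * Nᵀ)).IsSymm := by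
  refine IsSymm.smul ?_ _
  unfold Matrix.IsSymm
  rw [transpose_add, transpose_mul, transpose_mul, transpose_mul, transpose_mul,
    transpose_transpose, transpose_transpose, hK.eq, ← Matrix.mul_assoc, ← Matrix.mul_assoc,
    add_comm]

/-- `A B + B A` is symmetric for symmetric `A, B`. [folklore] -/
private theorem isSymm_mul_add_mul {A B : Matrix m m ℝ} (hA : A.IsSymm) (hB : B.IsSymm) :
    (A * B + B * A).IsSymm := by
  unfold Matrix.IsSymm
  rw [transpose_add, transpose_mul, transpose_mul, hA.eq, hB.eq, add_comm]

end General

/-! ## `svec`, `mat` and the inner product (14.37)–(14.38) -/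

section Svec

variable {n : Type*} [LinearOrder n]

/-- Upper-triangular positions `(i, j)`, `i ≤ j`, of an `n × n` matrix: the index set of `svec`
(`n(n+1)/2` of them). [cite: AntoniouLu2007, §14.4.2 (14.37)] -/
abbrev UIdx (n : Type*) [LinearOrder n] : Type _ := {p : n × n // p.1 ≤ p.2}

/-- (14.37): `svec K = [k₁₁, √2 k₁₂, …, √2 k₁ₙ, k₂₂, √2 k₂₃, …, kₙₙ]` — the upper triangle of `K`
with the off-diagonal entries scaled by `√2`. [cite: AntoniouLu2007, §14.4.2 (14.37)] -/
def svec (K : Matrix n n ℝ) : UIdx n → ℝ := fun p =>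
  if p.1.1 = p.1.2 then K p.1.1 p.1.2 else √2 * K p.1.1 p.1.2

/-- The book's `mat(·)`, "the inverse of `svec(·)`" ((14.41f)): the symmetric matrix with a given
`svec`. [cite: AntoniouLu2007, §14.4.3 (14.41f)] -/
def smat (v : UIdx n → ℝ) : Matrix n n ℝ := of fun i j =>
  if h : i ≤ j then (if i = j then v ⟨(i, j), h⟩ else v ⟨(i, j), h⟩ / √2)
  else v ⟨(j, i), (not_le.mp h).le⟩ / √2

/-- Diagonal entries of `mat(v)`. [cite: AntoniouLu2007, §14.4.2 (14.37), §14.4.3 (14.41f)] -/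
theorem smat_apply_same (v : UIdx n → ℝ) (i : n) : smat v i i = v ⟨(i, i), le_rfl⟩ := by
  simp [smat]

/-- Strictly upper entries of `mat(v)`: the `√2` of (14.37) is undone.
[cite: AntoniouLu2007, §14.4.2 (14.37), §14.4.3 (14.41f)] -/
theorem smat_apply_of_lt (v : UIdx n → ℝ) {i j : n} (h : i < j) :
    smat v i j = v ⟨(i, j), h.le⟩ / √2 := by
  simp [smat, h.le, h.ne]

/-- Strictly lower entries of `mat(v)`, by symmetry.
[cite: AntoniouLu2007, §14.4.2 (14.37), §14.4.3 (14.41f)] -/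
theorem smat_apply_of_gt (v : UIdx n → ℝ) {i j : n} (h : j < i) :
    smat v i j = v ⟨(j, i), h.le⟩ / √2 := by
  simp [smat, not_le.mpr h]

/-- `mat(v)` is symmetric. [cite: AntoniouLu2007, §14.4.3 (14.41f)] -/
theorem isSymm_smat (v : UIdx n → ℝ) : (smat v).IsSymm := by
  refine IsSymm.ext fun i j => ?_
  rcases lt_trichotomy i j with h | rfl | h
  · rw [smat_apply_of_lt v h, smat_apply_of_gt v h]
  · rfl
  · rw [smat_apply_of_gt v h, smat_apply_of_lt v h]

/-- `mat(svec K) = K` for symmetric `K`. [cite: AntoniouLu2007, §14.4.3 (14.41f), §14.4.4 Step 4] -/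
theorem smat_svec {K : Matrix n n ℝ} (hK : K.IsSymm) : smat (svec K) = K := by
  have h2 : (√2 : ℝ) ≠ 0 := by positivity
  ext i j
  rcases lt_trichotomy i j with h | rfl | h
  · rw [smat_apply_of_lt _ h]
    simp [svec, h.ne, mul_div_cancel_left₀ _ h2]
  · rw [smat_apply_same]
    simp [svec]
  · rw [smat_apply_of_gt _ h]
    simp [svec, h.ne, mul_div_cancel_left₀ _ h2, hK.apply i j]

/-- `svec(mat v) = v`. [cite: AntoniouLu2007, §14.4.3 (14.41f)] -/
theorem svec_smat (v : UIdx n → ℝ) : svec (smat v) = v := by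
  funext p
  obtain ⟨⟨i, j⟩, hp⟩ := p
  by_cases h : i = j
  · subst h
    simp [svec, smat_apply_same]
  · simp only [svec, h, if_false]
    rw [smat_apply_of_lt v (lt_of_le_of_ne hp h), mul_div_cancel₀ _ (by positivity : (√2 : ℝ) ≠ 0)]

/-- `svec` is injective on `𝒮ⁿ`. [cite: AntoniouLu2007, §14.4.2 (14.37)] -/
theorem svec_injective {A B : Matrix n n ℝ} (hA : A.IsSymm) (hB : B.IsSymm)
    (h : svec A = svec B) : A = B := by
  rw [← smat_svec hA, ← smat_svec hB, h]

/-- `svec A = svec B ⇔ A = B` on `𝒮ⁿ`. [cite: AntoniouLu2007, §14.4.2 (14.37)] -/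
theorem svec_inj {A B : Matrix n n ℝ} (hA : A.IsSymm) (hB : B.IsSymm) :
    svec A = svec B ↔ A = B :=
  ⟨svec_injective hA hB, fun h => h ▸ rfl⟩

/-- `svec` is additive. [cite: AntoniouLu2007, §14.4.2 (14.37)] -/
theorem svec_add (A B : Matrix n n ℝ) : svec (A + B) = svec A + svec B := by
  funext p
  simp only [svec, Matrix.add_apply, Pi.add_apply]
  split_ifs <;> ring

/-- `svec` is homogeneous. [cite: AntoniouLu2007, §14.4.2 (14.37)] -/
theorem svec_smul (c : ℝ) (A : Matrix n n ℝ) : svec (c • A) = c • svec A := by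
  funext p
  simp only [svec, Matrix.smul_apply, Pi.smul_apply, smul_eq_mul]
  split_ifs <;> ring

/-- `svec 0 = 0`. [cite: AntoniouLu2007, §14.4.2 (14.37)] -/
theorem svec_zero : svec (0 : Matrix n n ℝ) = 0 := by
  funext p; simp [svec]

/-- `svec` respects differences (used for `r_d = svec[C − S − mat(Aᵀy)]`, (14.41f)).
[cite: AntoniouLu2007, §14.4.2 (14.37), §14.4.3 (14.41f)] -/
theorem svec_sub (A B : Matrix n n ℝ) : svec (A - B) = svec A - svec B := by
  rw [sub_eq_add_neg, svec_add, ← neg_one_smul ℝ B, svec_smul, neg_one_smul, ← sub_eq_add_neg]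

/-- `mat` is additive. [cite: AntoniouLu2007, §14.4.3 (14.41f)] -/
theorem smat_add (u v : UIdx n → ℝ) : smat (u + v) = smat u + smat v := by
  ext i j
  rcases lt_trichotomy i j with h | rfl | h
  · rw [Matrix.add_apply, smat_apply_of_lt _ h, smat_apply_of_lt _ h, smat_apply_of_lt _ h,
      Pi.add_apply, add_div]
  · rw [Matrix.add_apply, smat_apply_same, smat_apply_same, smat_apply_same, Pi.add_apply]
  · rw [Matrix.add_apply, smat_apply_of_gt _ h, smat_apply_of_gt _ h, smat_apply_of_gt _ h,
      Pi.add_apply, add_div]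

/-- `mat` is homogeneous. [cite: AntoniouLu2007, §14.4.3 (14.41f)] -/
theorem smat_smul (c : ℝ) (v : UIdx n → ℝ) : smat (c • v) = c • smat v := by
  ext i j
  rcases lt_trichotomy i j with h | rfl | h
  · rw [Matrix.smul_apply, smat_apply_of_lt _ h, smat_apply_of_lt _ h, Pi.smul_apply,
      smul_eq_mul, smul_eq_mul, mul_div_assoc]
  · rw [Matrix.smul_apply, smat_apply_same, smat_apply_same, Pi.smul_apply]
  · rw [Matrix.smul_apply, smat_apply_of_gt _ h, smat_apply_of_gt _ h, Pi.smul_apply,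
      smul_eq_mul, smul_eq_mul, mul_div_assoc]

variable [Fintype n]

/-- Splitting a sum over `n × n` of a symmetric function into diagonal and (doubled) strictly
upper-triangular parts, indexed by `UIdx n`. [folklore] -/
private theorem sum_prod_eq_sum_uIdx (f : n × n → ℝ) (hf : ∀ i j, f (j, i) = f (i, j)) :
    ∑ q : n × n, f q = ∑ p : UIdx n, (if p.1.1 = p.1.2 then f p.1 else 2 * f p.1) := by
  classical
  set U : Finset (n × n) := Finset.univ.filter (fun q : n × n => q.1 ≤ q.2) with hU
  set L : Finset (n × n) := Finset.univ.filter (fun q : n × n => q.1 < q.2) with hL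
  have hsplit : ∑ q : n × n, f q
      = ∑ q ∈ U, f q + ∑ q ∈ Finset.univ.filter (fun q : n × n => ¬ q.1 ≤ q.2), f q :=
    (Finset.sum_filter_add_sum_filter_not _ _ f).symm
  have hswap : ∑ q ∈ Finset.univ.filter (fun q : n × n => ¬ q.1 ≤ q.2), f q = ∑ q ∈ L, f q := by
    refine Finset.sum_equiv (Equiv.prodComm n n) (fun q => ?_) (fun q _ => ?_)
    · simp [hL, not_le]
    · obtain ⟨i, j⟩ := q
      simpa using hf j i
  have hsub : ∑ p : UIdx n, (if p.1.1 = p.1.2 then f p.1 else 2 * f p.1)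
      = ∑ q ∈ U, (if q.1 = q.2 then f q else 2 * f q) :=
    (Finset.sum_subtype U (fun q => by simp [hU]) (fun q : n × n => if q.1 = q.2 then f q
      else 2 * f q)).symm
  have hite : ∀ q : n × n, (if q.1 = q.2 then f q else 2 * f q)
      = f q + (if q.1 = q.2 then 0 else f q) := by
    intro q; split_ifs <;> ring
  have hUL : U.filter (fun q : n × n => ¬ q.1 = q.2) = L := by
    ext q
    simp only [hU, hL, Finset.mem_filter, Finset.mem_univ, true_and]
    exact ⟨fun h => lt_of_le_of_ne h.1 h.2, fun h => ⟨h.le, h.ne⟩⟩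
  rw [hsplit, hswap, hsub, Finset.sum_congr rfl fun q _ => hite q, Finset.sum_add_distrib,
    Finset.sum_ite, Finset.sum_const_zero, zero_add, hUL]

/-- (14.38) / Problem 14.7(b): the inner product of `𝒮ⁿ` is the standard inner product of the
`svec`'s, `A • B = svec(A)ᵀ svec(B)`. [cite: AntoniouLu2007, §14.4.2 (14.38); Problem 14.7(b)] -/
theorem svec_dotProduct_svec {A B : Matrix n n ℝ} (hA : A.IsSymm) (hB : B.IsSymm) :
    svec A ⬝ᵥ svec B = (A * B).trace := by
  have h1 : svec A ⬝ᵥ svec B = ∑ p : UIdx n,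
      (if p.1.1 = p.1.2 then A p.1.1 p.1.2 * B p.1.1 p.1.2
        else 2 * (A p.1.1 p.1.2 * B p.1.1 p.1.2)) := by
    simp only [dotProduct, svec]
    refine Finset.sum_congr rfl fun p _ => ?_
    split_ifs with h
    · rfl
    · calc √2 * A p.1.1 p.1.2 * (√2 * B p.1.1 p.1.2)
          = (√2 * √2) * (A p.1.1 p.1.2 * B p.1.1 p.1.2) := by ring
        _ = 2 * (A p.1.1 p.1.2 * B p.1.1 p.1.2) := by rw [Real.mul_self_sqrt zero_le_two]
  -- (A.75) `tr(AB) = Σᵢⱼ aᵢⱼ bᵢⱼ` (in the tree as `…LovaszThetaDual.trace_mul_eq_sum_of_transpose`)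
  have h2 : (A * B).trace = ∑ q : n × n, A q.1 q.2 * B q.1 q.2 := by
    have h3 : (A * B).trace = ∑ i, ∑ j, A i j * B i j := by
      simp only [trace, diag_apply, mul_apply]
      exact Finset.sum_congr rfl fun i _ => Finset.sum_congr rfl fun j _ => by rw [hB.apply i j]
    rw [h3]
    exact (Fintype.sum_prod_type fun q : n × n => A q.1 q.2 * B q.1 q.2).symm
  rw [h1, h2, sum_prod_eq_sum_uIdx (fun q : n × n => A q.1 q.2 * B q.1 q.2) fun i j => by
    simp only [hA.apply i j, hB.apply i j]]

/-- (A.76): `‖svec A‖² = A • A = Σᵢⱼ aᵢⱼ² = ‖A‖_F²`. [cite: AntoniouLu2007, §A.15 (A.76)] -/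
theorem svec_dotProduct_self {A : Matrix n n ℝ} (hA : A.IsSymm) :
    svec A ⬝ᵥ svec A = ∑ i, ∑ j, A i j ^ 2 := by
  rw [svec_dotProduct_svec hA hA]
  simp only [trace, diag_apply, mul_apply, sq]
  exact Finset.sum_congr rfl fun i _ => Finset.sum_congr rfl fun j _ => by rw [hA.apply i j]

/-! ## The symmetric Kronecker product (14.36) -/

/-- The linear map `v ↦ svec(½ (N mat(v) Mᵀ + M mat(v) Nᵀ))` on `ℝ^{n(n+1)/2}` whose matrix is
`M ⊛ N`. [cite: AntoniouLu2007, §14.4.2 (14.36)] -/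
def skronLin (M N : Matrix n n ℝ) : (UIdx n → ℝ) →ₗ[ℝ] (UIdx n → ℝ) where
  toFun v := svec ((1 / 2 : ℝ) • (N * smat v * Mᵀ + M * smat v * Nᵀ))
  map_add' u v := by
    rw [smat_add]
    simp only [Matrix.mul_add, Matrix.add_mul, smul_add, svec_add]
    abel
  map_smul' c v := by
    rw [smat_smul, RingHom.id_apply, ← svec_smul, Matrix.mul_smul, Matrix.smul_mul,
      Matrix.mul_smul, Matrix.smul_mul, ← smul_add, smul_comm]

/-- The symmetric Kronecker product `M ⊛ N ∈ ℝ^{n(n+1)/2 × n(n+1)/2}` ((14.36)); concretely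
(Problem 14.8: "by using Eq. (14.36) with a special symmetric matrix `K`" the matrix is determined
line by line) its column at position `q = (i, j)` is `svec(½ (N E_q Mᵀ + M E_q Nᵀ))` where
`E_q = mat(e_q)` is the symmetric matrix with a single nonzero upper-triangular position.
[cite: AntoniouLu2007, §14.4.2 (14.36); Problem 14.8] -/
def skron (M N : Matrix n n ℝ) : Matrix (UIdx n) (UIdx n) ℝ := LinearMap.toMatrix' (skronLin M N)

/-- Problem 14.8: the columns of `M ⊛ N`. [cite: AntoniouLu2007, §14.4.2, Problem 14.8] -/
theorem skron_apply (M N : Matrix n n ℝ) (p q : UIdx n) :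
    skron M N p q = svec ((1 / 2 : ℝ) • (N * smat (Pi.single q 1) * Mᵀ
      + M * smat (Pi.single q 1) * Nᵀ)) p := by
  rw [skron, LinearMap.toMatrix'_apply]; rfl

/-- `(M ⊛ N) v = svec(½ (N mat(v) Mᵀ + M mat(v) Nᵀ))`. [cite: AntoniouLu2007, §14.4.2 (14.36)] -/
theorem skron_mulVec (M N : Matrix n n ℝ) (v : UIdx n → ℝ) :
    skron M N *ᵥ v = svec ((1 / 2 : ℝ) • (N * smat v * Mᵀ + M * smat v * Nᵀ)) := by
  rw [skron, LinearMap.toMatrix'_mulVec]; rfl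

/-- (14.36), the defining identity: `(M ⊛ N) svec(K) = svec(½ (N K Mᵀ + M K Nᵀ))` for every
symmetric `K`. [cite: AntoniouLu2007, §14.4.2 (14.36)] -/
theorem skron_mulVec_svec (M N : Matrix n n ℝ) {K : Matrix n n ℝ} (hK : K.IsSymm) :
    skron M N *ᵥ svec K = svec ((1 / 2 : ℝ) • (N * K * Mᵀ + M * K * Nᵀ)) := by
  rw [skron_mulVec, smat_svec hK]

/-- (14.36) determines `M ⊛ N`: a matrix satisfying the identity on all of `𝒮ⁿ` is `M ⊛ N`.
[cite: AntoniouLu2007, §14.4.2 (14.36)] -/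
theorem eq_skron {M N : Matrix n n ℝ} {P : Matrix (UIdx n) (UIdx n) ℝ}
    (h : ∀ K : Matrix n n ℝ, K.IsSymm →
      P *ᵥ svec K = svec ((1 / 2 : ℝ) • (N * K * Mᵀ + M * K * Nᵀ))) :
    P = skron M N :=
  ext_iff_mulVec.mpr fun v => by
    rw [← svec_smat v, h _ (isSymm_smat v), skron_mulVec_svec _ _ (isSymm_smat v)]

/-- `M ⊛ N = N ⊛ M`. [cite: AntoniouLu2007, §14.4.2 (14.36)] -/
theorem skron_comm (M N : Matrix n n ℝ) : skron M N = skron N M :=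
  ext_iff_mulVec.mpr fun v => by rw [skron_mulVec, skron_mulVec, add_comm]

/-- The bilinear form of `M ⊛ N`: `uᵀ (M ⊛ N) v = tr(U N V Mᵀ)` with `U = mat(u)`, `V = mat(v)`.
[cite: AntoniouLu2007, §14.4.2 (14.36), (14.38)] -/
theorem dotProduct_skron_mulVec (M N : Matrix n n ℝ) (u v : UIdx n → ℝ) :
    u ⬝ᵥ (skron M N *ᵥ v) = (smat u * N * smat v * Mᵀ).trace := by
  rw [skron_mulVec]
  conv_lhs => rw [← svec_smat u]
  rw [svec_dotProduct_svec (isSymm_smat u) (isSymm_symm_term M N (isSymm_smat v)),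
    Matrix.mul_smul, trace_smul, Matrix.mul_add, trace_add, smul_eq_mul]
  have h : (smat u * (M * smat v * Nᵀ)).trace = (smat u * (N * smat v * Mᵀ)).trace := by
    rw [← trace_transpose, transpose_mul, transpose_mul, transpose_mul, transpose_transpose,
      (isSymm_smat u).eq, (isSymm_smat v).eq, trace_mul_comm]
    simp only [← Matrix.mul_assoc]
  rw [h]
  simp only [← Matrix.mul_assoc]
  ring

/-- `(M ⊛ N)ᵀ = Mᵀ ⊛ Nᵀ`. [cite: AntoniouLu2007, §14.4.2 (14.36)] -/
theorem skron_transpose (M N : Matrix n n ℝ) : (skron M N)ᵀ = skron Mᵀ Nᵀ := by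
  refine ext_iff_mulVec.mpr fun v => (dotProduct_eq_iff.mp fun u => ?_)
  rw [dotProduct_comm, dotProduct_comm (skron Mᵀ Nᵀ *ᵥ v), dotProduct_mulVec u,
    vecMul_transpose, dotProduct_comm, dotProduct_skron_mulVec, dotProduct_skron_mulVec,
    transpose_transpose, ← trace_transpose, transpose_mul, transpose_mul, transpose_mul,
    transpose_transpose, (isSymm_smat u).eq, (isSymm_smat v).eq, ← Matrix.mul_assoc,
    ← Matrix.mul_assoc, Matrix.mul_assoc M, Matrix.mul_assoc M, trace_mul_comm M]

/-- For symmetric `M, N` the matrix `M ⊛ N` is symmetric (so Lemma 14.1 speaks of an orthonormal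
eigenbasis). [cite: AntoniouLu2007, §14.4.2 Lemma 14.1] -/
theorem isSymm_skron {M N : Matrix n n ℝ} (hM : M.IsSymm) (hN : N.IsSymm) :
    (skron M N).IsSymm := by
  unfold Matrix.IsSymm
  rw [skron_transpose, hM.eq, hN.eq]

/-- `I ⊛ I = I`. [cite: AntoniouLu2007, §14.4.2 (14.36)] -/
theorem skron_one_one : skron (1 : Matrix n n ℝ) 1 = 1 :=
  ext_iff_mulVec.mpr fun v => by
    rw [skron_mulVec, one_mulVec, transpose_one, Matrix.mul_one, Matrix.one_mul, ← two_smul ℝ,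
      smul_smul, show (1 / 2 : ℝ) * 2 = 1 by norm_num, one_smul, svec_smat]

/-- `(M ⊛ I) svec(K) = svec(½ (K Mᵀ + M K))` — the form in which `E = S ⊛ I`, `F = X ⊛ I`
enter (14.40c,d). [cite: AntoniouLu2007, §14.4.3 (14.39)–(14.40)] -/
theorem skron_one_mulVec_svec (M : Matrix n n ℝ) {K : Matrix n n ℝ} (hK : K.IsSymm) :
    skron M 1 *ᵥ svec K = svec ((1 / 2 : ℝ) • (K * Mᵀ + M * K)) := by
  rw [skron_mulVec_svec _ _ hK, Matrix.one_mul, transpose_one, Matrix.mul_one]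

/-! ## Lemma 14.1: eigenvalues and eigenvectors of `M ⊛ N` (Problem 14.9) -/

/-- Lemma 14.1 (off-diagonal eigenvectors, `i < j`): if `v, w` are simultaneous eigenvectors,
`M v = α v`, `M w = α' w`, `N v = β v`, `N w = β' w`, then
`(M ⊛ N) svec(v wᵀ + w vᵀ) = ½ (α β' + β α') svec(v wᵀ + w vᵀ)`.
[cite: AntoniouLu2007, §14.4.2 Lemma 14.1; Problem 14.9] -/
theorem skron_mulVec_svec_eigenpair {M N : Matrix n n ℝ} {v w : n → ℝ} {α α' β β' : ℝ}
    (hv : M *ᵥ v = α • v) (hw : M *ᵥ w = α' • w) (hv' : N *ᵥ v = β • v)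
    (hw' : N *ᵥ w = β' • w) :
    skron M N *ᵥ svec (vecMulVec v w + vecMulVec w v)
      = ((α * β' + β * α') / 2) • svec (vecMulVec v w + vecMulVec w v) := by
  have hK : (vecMulVec v w + vecMulVec w v).IsSymm := by
    unfold Matrix.IsSymm; rw [transpose_add, transpose_vecMulVec, transpose_vecMulVec, add_comm]
  have hmat : N * (vecMulVec v w + vecMulVec w v) * Mᵀ + M * (vecMulVec v w + vecMulVec w v) * Nᵀ
      = (α * β' + β * α') • (vecMulVec v w + vecMulVec w v) := by
    ext i j
    simp only [Matrix.mul_add, Matrix.add_mul, mul_vecMulVec, vecMulVec_mul, vecMul_transpose,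
      hv, hw, hv', hw', Matrix.add_apply, vecMulVec_apply, Pi.smul_apply, smul_eq_mul,
      Matrix.smul_apply]
    ring
  rw [skron_mulVec_svec _ _ hK, hmat, smul_smul, svec_smul]
  congr 1
  ring

/-- Lemma 14.1 (diagonal eigenvectors, `i = j`): `(M ⊛ N) svec(v vᵀ) = α β svec(v vᵀ)` when
`M v = α v`, `N v = β v`. [cite: AntoniouLu2007, §14.4.2 Lemma 14.1; Problem 14.9] -/
theorem skron_mulVec_svec_eigen_self {M N : Matrix n n ℝ} {v : n → ℝ} {α β : ℝ}
    (hv : M *ᵥ v = α • v) (hv' : N *ᵥ v = β • v) :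
    skron M N *ᵥ svec (vecMulVec v v) = (α * β) • svec (vecMulVec v v) := by
  have hK : (vecMulVec v v).IsSymm := by unfold Matrix.IsSymm; rw [transpose_vecMulVec]
  have hmat : N * vecMulVec v v * Mᵀ + M * vecMulVec v v * Nᵀ = (2 * (α * β)) • vecMulVec v v := by
    ext i j
    simp only [mul_vecMulVec, vecMulVec_mul, vecMul_transpose, hv, hv', Matrix.add_apply,
      vecMulVec_apply, Pi.smul_apply, smul_eq_mul, Matrix.smul_apply]
    ring
  rw [skron_mulVec_svec _ _ hK, hmat, smul_smul, svec_smul]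
  congr 1
  ring

/-- Gram identity behind the orthonormality clause of Lemma 14.1:
`svec(p qᵀ + q pᵀ) ⬝ svec(r sᵀ + s rᵀ) = 2 ((p⬝r)(q⬝s) + (p⬝s)(q⬝r))`.
[cite: AntoniouLu2007, §14.4.2 Lemma 14.1, (14.38)] -/
theorem svec_symm_dotProduct_svec_symm (p q r s : n → ℝ) :
    svec (vecMulVec p q + vecMulVec q p) ⬝ᵥ svec (vecMulVec r s + vecMulVec s r)
      = 2 * ((p ⬝ᵥ r) * (q ⬝ᵥ s) + (p ⬝ᵥ s) * (q ⬝ᵥ r)) := by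
  have h1 : (vecMulVec p q + vecMulVec q p).IsSymm := by
    unfold Matrix.IsSymm; rw [transpose_add, transpose_vecMulVec, transpose_vecMulVec, add_comm]
  have h2 : (vecMulVec r s + vecMulVec s r).IsSymm := by
    unfold Matrix.IsSymm; rw [transpose_add, transpose_vecMulVec, transpose_vecMulVec, add_comm]
  rw [svec_dotProduct_svec h1 h2]
  simp only [Matrix.mul_add, Matrix.add_mul, vecMulVec_mul_vecMulVec, trace_add, trace_vecMulVec,
    dotProduct_smul, smul_eq_mul]
  ring

/-- `svec(p pᵀ) ⬝ svec(r rᵀ) = (p ⬝ r)²`. [cite: AntoniouLu2007, §14.4.2 Lemma 14.1, (14.38)] -/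
theorem svec_self_dotProduct_svec_self (p r : n → ℝ) :
    svec (vecMulVec p p) ⬝ᵥ svec (vecMulVec r r) = (p ⬝ᵥ r) ^ 2 := by
  have h1 : (vecMulVec p p).IsSymm := by unfold Matrix.IsSymm; rw [transpose_vecMulVec]
  have h2 : (vecMulVec r r).IsSymm := by unfold Matrix.IsSymm; rw [transpose_vecMulVec]
  rw [svec_dotProduct_svec h1 h2, vecMulVec_mul_vecMulVec, trace_vecMulVec, dotProduct_smul,
    smul_eq_mul, sq]

/-- `svec(p pᵀ) ⬝ svec(r sᵀ + s rᵀ) = 2 (p ⬝ r)(p ⬝ s)`.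
[cite: AntoniouLu2007, §14.4.2 Lemma 14.1, (14.38)] -/
theorem svec_self_dotProduct_svec_symm (p r s : n → ℝ) :
    svec (vecMulVec p p) ⬝ᵥ svec (vecMulVec r s + vecMulVec s r) = 2 * (p ⬝ᵥ r) * (p ⬝ᵥ s) := by
  have h1 : (vecMulVec p p).IsSymm := by unfold Matrix.IsSymm; rw [transpose_vecMulVec]
  have h2 : (vecMulVec r s + vecMulVec s r).IsSymm := by
    unfold Matrix.IsSymm; rw [transpose_add, transpose_vecMulVec, transpose_vecMulVec, add_comm]
  rw [svec_dotProduct_svec h1 h2]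
  simp only [Matrix.mul_add, vecMulVec_mul_vecMulVec, trace_add, trace_vecMulVec,
    dotProduct_smul, smul_eq_mul]
  ring

/-- Lemma 14.1, orthonormality (`i = j`): `‖svec(vᵢ vᵢᵀ)‖ = 1` for a unit vector.
[cite: AntoniouLu2007, §14.4.2 Lemma 14.1] -/
theorem eigvec_norm_sq {v : n → ℝ} (hv : v ⬝ᵥ v = 1) :
    svec (vecMulVec v v) ⬝ᵥ svec (vecMulVec v v) = 1 := by
  rw [svec_self_dotProduct_svec_self, hv, one_pow]

/-- Lemma 14.1, orthonormality (`i < j`): `‖(1/√2) svec(vᵢ vⱼᵀ + vⱼ vᵢᵀ)‖ = 1` for orthogonal unit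
vectors, i.e. `‖svec(vᵢ vⱼᵀ + vⱼ vᵢᵀ)‖² = 2`. [cite: AntoniouLu2007, §14.4.2 Lemma 14.1] -/
theorem eigvec_offDiag_norm_sq {v w : n → ℝ} (hv : v ⬝ᵥ v = 1) (hw : w ⬝ᵥ w = 1)
    (hvw : v ⬝ᵥ w = 0) :
    svec (vecMulVec v w + vecMulVec w v) ⬝ᵥ svec (vecMulVec v w + vecMulVec w v) = 2 := by
  rw [svec_symm_dotProduct_svec_symm, hv, hw, hvw, dotProduct_comm w v, hvw]; ring

/-- Lemma 14.1, orthogonality of eigenvectors attached to different index pairs: for pairwise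
orthogonal `u, v, w`, `svec(u uᵀ) ⊥ svec(v wᵀ + w vᵀ)`, `svec(u uᵀ) ⊥ svec(v vᵀ)` and
`svec(u vᵀ + v uᵀ) ⊥ svec(u wᵀ + w uᵀ)`. [cite: AntoniouLu2007, §14.4.2 Lemma 14.1] -/
theorem eigvec_orthogonal {u v w : n → ℝ} (huv : u ⬝ᵥ v = 0) (huw : u ⬝ᵥ w = 0)
    (hvw : v ⬝ᵥ w = 0) :
    svec (vecMulVec u u) ⬝ᵥ svec (vecMulVec v w + vecMulVec w v) = 0
      ∧ svec (vecMulVec u u) ⬝ᵥ svec (vecMulVec v v) = 0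
      ∧ svec (vecMulVec u v + vecMulVec v u) ⬝ᵥ svec (vecMulVec u w + vecMulVec w u) = 0 := by
  refine ⟨?_, ?_, ?_⟩
  · rw [svec_self_dotProduct_svec_symm, huv]; ring
  · rw [svec_self_dotProduct_svec_self, huv]; ring
  · rw [svec_symm_dotProduct_svec_symm, huw, hvw, dotProduct_comm v u, huv]; ring

/-! ## §14.4.3: the Newton equations in `svec` form, (14.39) -/

/-- (14.39): for symmetric `X, S, ΔX, ΔS` the linearised centering equation (14.34c),
`X ΔS + ΔS X + ΔX S + S ΔX = 2τ I − X S − S X`, is equivalent to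
`(X ⊛ I) svec(ΔS) + (S ⊛ I) svec(ΔX) = svec(τ I − ½ (X S + S X))`, i.e. `E Δx + F Δs = r_c` with
(14.40). [cite: AntoniouLu2007, §14.4.3 (14.39)–(14.40)] -/
theorem newton_centering_iff_svec {X S ΔX ΔS : Matrix n n ℝ} (hX : X.IsSymm) (hS : S.IsSymm)
    (hΔX : ΔX.IsSymm) (hΔS : ΔS.IsSymm) (τ : ℝ) :
    X * ΔS + ΔS * X + ΔX * S + S * ΔX = (2 * τ) • (1 : Matrix n n ℝ) - X * S - S * X
      ↔ skron X 1 *ᵥ svec ΔS + skron S 1 *ᵥ svec ΔX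
        = svec (τ • (1 : Matrix n n ℝ) - (1 / 2 : ℝ) • (X * S + S * X)) := by
  rw [skron_one_mulVec_svec X hΔS, skron_one_mulVec_svec S hΔX, hX.eq, hS.eq, ← svec_add,
    ← smul_add]
  have hP : ((1 / 2 : ℝ) • (ΔS * X + X * ΔS + (ΔX * S + S * ΔX))).IsSymm :=
    ((isSymm_mul_add_mul hΔS hX).add (isSymm_mul_add_mul hΔX hS)).smul _
  have hQ : (τ • (1 : Matrix n n ℝ) - (1 / 2 : ℝ) • (X * S + S * X)).IsSymm :=
    (isSymm_one.smul τ).sub ((isSymm_mul_add_mul hX hS).smul _)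
  rw [svec_inj hP hQ]
  constructor
  · intro h
    have h' : ΔS * X + X * ΔS + (ΔX * S + S * ΔX)
        = (2 * τ) • (1 : Matrix n n ℝ) - X * S - S * X := by
      rw [← h]; abel
    rw [h', sub_sub, smul_sub, smul_smul, show (1 / 2 : ℝ) * (2 * τ) = τ by ring]
  · intro h
    have h' := congrArg (fun A : Matrix n n ℝ => (2 : ℝ) • A) h
    simp only [smul_smul, smul_sub] at h'
    norm_num at h'
    rw [← sub_sub] at h'
    rw [← h']
    abel

end Svec

section Block

variable {R : Type*} [CommRing R] {σ ρ : Type*} [Fintype σ] [Fintype ρ] [DecidableEq σ]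

/-- (14.42) ⇔ (14.43) / Problem 14.11: with `E` invertible, `(Δx, Δy, Δs)` solves the block system
`Aᵀ Δy + Δs = r_d`, `A Δx = r_p`, `E Δx + F Δs = r_c` iff `Δs = r_d − Aᵀ Δy` ((14.43b)),
`Δx = −E⁻¹ [F (r_d − Aᵀ Δy) − r_c]` ((14.43a)) and `Δy` solves the Schur-complement system
`M Δy = r_p + A E⁻¹ (F r_d − r_c)`, `M = A E⁻¹ F Aᵀ` ((14.43c)).
[cite: AntoniouLu2007, §14.4.3 (14.42)–(14.43); Problem 14.11] -/
theorem newton_system_iff {E F : Matrix σ σ R} {A : Matrix ρ σ R} (hE : IsUnit E.det)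
    (r_d r_c Δx Δs : σ → R) (r_p Δy : ρ → R) :
    (Aᵀ *ᵥ Δy + Δs = r_d ∧ A *ᵥ Δx = r_p ∧ E *ᵥ Δx + F *ᵥ Δs = r_c)
      ↔ (Δs = r_d - Aᵀ *ᵥ Δy ∧ Δx = -(E⁻¹ *ᵥ (F *ᵥ (r_d - Aᵀ *ᵥ Δy) - r_c))
        ∧ (A * E⁻¹ * F * Aᵀ) *ᵥ Δy = r_p + (A * E⁻¹) *ᵥ (F *ᵥ r_d - r_c)) := by
  have key : A *ᵥ (-(E⁻¹ *ᵥ (F *ᵥ (r_d - Aᵀ *ᵥ Δy) - r_c)))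
      = (A * E⁻¹ * F * Aᵀ) *ᵥ Δy - (A * E⁻¹) *ᵥ (F *ᵥ r_d - r_c) := by
    simp only [mulVec_neg, mulVec_sub, mulVec_mulVec, Matrix.mul_assoc]
    abel
  constructor
  · rintro ⟨h1, h2, h3⟩
    have hs : Δs = r_d - Aᵀ *ᵥ Δy := by rw [← h1]; abel
    have hx : Δx = -(E⁻¹ *ᵥ (F *ᵥ (r_d - Aᵀ *ᵥ Δy) - r_c)) := by
      rw [← hs, ← mulVec_neg, neg_sub, ← h3, add_sub_cancel_right, mulVec_mulVec,
        nonsing_inv_mul _ hE, one_mulVec]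
    refine ⟨hs, hx, ?_⟩
    rw [hx, key] at h2
    exact sub_eq_iff_eq_add.mp h2
  · rintro ⟨hs, hx, hM⟩
    refine ⟨?_, ?_, ?_⟩
    · rw [hs]; abel
    · rw [hx, key, hM]; abel
    · rw [hx, ← hs, mulVec_neg, mulVec_mulVec, mul_nonsing_inv _ hE, one_mulVec]; abel

end Block

/-! ## Problem 14.6: `XS = τI` versus `XS + SX = 2τI` -/

section Centering

variable {m : Type*} [Fintype m] [DecidableEq m]

omit [DecidableEq m] in
/-- The key step of Problem 14.6(a): if `X ≻ 0` and `X T + T X = 0` then `T = 0` (take traces of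
`Tᵀ (X T + T X) = 0`: `tr(Tᵀ X T) + tr(T X Tᵀ) = 0` with both terms `≥ 0`, so every row `t` of
`T` has `tᵀ X t = 0`, i.e. `t = 0`). [cite: AntoniouLu2007, §14.4.1 (14.32); Problem 14.6(a)] -/
theorem eq_zero_of_posDef_of_mul_add_mul_eq_zero {X : Matrix m m ℝ} (hX : X.PosDef)
    {T : Matrix m m ℝ} (h : X * T + T * X = 0) : T = 0 := by
  have hq : ∀ B : Matrix m m ℝ, (B * X * Bᵀ).trace = ∑ k, B k ⬝ᵥ X *ᵥ B k := fun B => by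
    simp only [trace, diag_apply, mul_mul_apply, transpose_transpose]
  have hnn' : ∀ (B : Matrix m m ℝ) (k : m), 0 ≤ B k ⬝ᵥ X *ᵥ B k := fun B k => by
    simpa using hX.posSemidef.dotProduct_mulVec_nonneg (B k)
  have hnn : ∀ B : Matrix m m ℝ, 0 ≤ (B * X * Bᵀ).trace := fun B => by
    rw [hq]
    exact Finset.sum_nonneg fun k _ => hnn' B k
  have h1 : (Tᵀ * X * T).trace + (T * X * Tᵀ).trace = 0 := by
    have h0 : (Tᵀ * (X * T + T * X)).trace = (Tᵀ * 0).trace := by rw [h]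
    rwa [Matrix.mul_add, trace_add, trace_mul_comm Tᵀ (T * X), ← Matrix.mul_assoc,
      Matrix.mul_zero, trace_zero] at h0
  have h2 : (T * X * Tᵀ).trace = 0 := by
    have ha := hnn Tᵀ
    rw [transpose_transpose] at ha
    exact le_antisymm (by linarith [hnn T]) (hnn T)
  rw [hq] at h2
  have hrow : ∀ k, T k = 0 := by
    intro k
    by_contra hk
    have hpos := hX.dotProduct_mulVec_pos hk
    simp only [star_trivial] at hpos
    have hle : T k ⬝ᵥ X *ᵥ T k ≤ 0 := by
      rw [← h2]
      exact Finset.single_le_sum (f := fun k => T k ⬝ᵥ X *ᵥ T k) (fun i _ => hnn' T i)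
        (Finset.mem_univ k)
    linarith
  ext i j
  exact congrFun (hrow i) j

/-- `X S = τ I ⇔ S X = τ I` when `S` is invertible. [folklore] -/
private theorem mul_eq_smul_one_comm {X S : Matrix m m ℝ} (hS : IsUnit S.det) (τ : ℝ) :
    X * S = τ • (1 : Matrix m m ℝ) ↔ S * X = τ • (1 : Matrix m m ℝ) := by
  constructor
  · intro h
    have hX : X = τ • S⁻¹ := by
      rw [← mul_nonsing_inv_cancel_right S X hS, h, Matrix.smul_mul, Matrix.one_mul]
    rw [hX, Matrix.mul_smul, mul_nonsing_inv _ hS]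
  · intro h
    have hX : X = τ • S⁻¹ := by
      rw [← nonsing_inv_mul_cancel_left S X hS, h, Matrix.mul_smul, Matrix.mul_one]
    rw [hX, Matrix.smul_mul, nonsing_inv_mul _ hS]

/-- Problem 14.6(a), `X ≻ 0`: the centering condition `X S = τ I` ((14.25c)) is equivalent to its
symmetrisation `X S + S X = 2τ I` ((14.32)); no hypothesis on `S` is needed.
[cite: AntoniouLu2007, §14.4.1 (14.32); Problem 14.6(a)] -/
theorem mul_eq_smul_one_iff_of_posDef_left {X : Matrix m m ℝ} (hX : X.PosDef)
    (S : Matrix m m ℝ) (τ : ℝ) :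
    X * S = τ • (1 : Matrix m m ℝ) ↔ X * S + S * X = (2 * τ) • (1 : Matrix m m ℝ) := by
  have hdet : IsUnit X.det := (isUnit_iff_isUnit_det X).mp hX.isUnit
  constructor
  · intro h
    have hS : S = τ • X⁻¹ :=
      calc S = X⁻¹ * (X * S) := (nonsing_inv_mul_cancel_left X S hdet).symm
        _ = τ • X⁻¹ := by rw [h, Matrix.mul_smul, Matrix.mul_one]
    rw [hS, Matrix.mul_smul, Matrix.smul_mul, mul_nonsing_inv _ hdet, nonsing_inv_mul _ hdet,
      ← add_smul, two_mul]
  · intro h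
    have hT : X * (S - τ • X⁻¹) + (S - τ • X⁻¹) * X = 0 := by
      rw [Matrix.mul_sub, Matrix.sub_mul, Matrix.mul_smul, Matrix.smul_mul,
        mul_nonsing_inv _ hdet, nonsing_inv_mul _ hdet, sub_add_sub_comm, h, ← add_smul,
        ← two_mul, sub_self]
    have hS : S = τ • X⁻¹ := sub_eq_zero.mp (eq_zero_of_posDef_of_mul_add_mul_eq_zero hX hT)
    rw [hS, Matrix.mul_smul, mul_nonsing_inv _ hdet]

/-- Problem 14.6(a), `S ≻ 0`: likewise `X S = τ I ⇔ X S + S X = 2τ I`.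
[cite: AntoniouLu2007, §14.4.1 (14.32); Problem 14.6(a)] -/
theorem mul_eq_smul_one_iff_of_posDef_right (X : Matrix m m ℝ) {S : Matrix m m ℝ}
    (hS : S.PosDef) (τ : ℝ) :
    X * S = τ • (1 : Matrix m m ℝ) ↔ X * S + S * X = (2 * τ) • (1 : Matrix m m ℝ) := by
  have hdet : IsUnit S.det := (isUnit_iff_isUnit_det S).mp hS.isUnit
  rw [mul_eq_smul_one_comm hdet, mul_eq_smul_one_iff_of_posDef_left hS X τ, add_comm]

/-- Problem 14.6(b): without definiteness the two conditions are not equivalent — for the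
symmetric indefinite `X = diag(1, −1)` and `S = [[0, 1], [1, 0]]` one has `X S + S X = 0 = 2·0·I`
but `X S ≠ 0·I`. [cite: AntoniouLu2007, Problem 14.6(b)] -/
theorem exists_symm_pair_not_equiv :
    ∃ X S : Matrix (Fin 2) (Fin 2) ℝ, X.IsSymm ∧ S.IsSymm
      ∧ X * S + S * X = (2 * (0 : ℝ)) • (1 : Matrix (Fin 2) (Fin 2) ℝ)
      ∧ X * S ≠ (0 : ℝ) • (1 : Matrix (Fin 2) (Fin 2) ℝ) := by
  refine ⟨!![1, 0; 0, -1], !![0, 1; 1, 0], ?_, ?_, ?_, ?_⟩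
  · exact IsSymm.ext fun i j => by fin_cases i <;> fin_cases j <;> simp
  · exact IsSymm.ext fun i j => by fin_cases i <;> fin_cases j <;> simp
  · ext i j
    fin_cases i <;> fin_cases j <;> simp
  · intro h
    have h01 := congrFun (congrFun h 0) 1
    simp at h01

end Centering

/-! ## Problem 14.10: the Lyapunov-type equation `M X Nᵀ + N X Mᵀ = B` -/

section Lyapunov

variable {m : Type*} [Fintype m] [DecidableEq m]

/-- Problem 14.10: if `M` and `N` have a common orthonormal eigenbasis `V = [v₁ ⋯ vₙ]`
(`Vᵀ V = I`, `M V = V diag(α)`, `N V = V diag(β)` — e.g. commuting symmetric `M, N`, Lemma 14.1)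
and `C` is `Vᵀ B V` divided entrywise by `αᵢ βⱼ + βᵢ αⱼ` (stated multiplied out), then
`X = V C Vᵀ` solves `M X Nᵀ + N X Mᵀ = B`. [cite: AntoniouLu2007, Problem 14.10; Lemma 14.1] -/
theorem lyapunov_solution_of_common_eigenbasis {M N B V C : Matrix m m ℝ} {α β : m → ℝ}
    (hV : Vᵀ * V = 1) (hM : M * V = V * diagonal α) (hN : N * V = V * diagonal β)
    (hC : ∀ i j, C i j * (α i * β j + β i * α j) = (Vᵀ * B * V) i j) :
    M * (V * C * Vᵀ) * Nᵀ + N * (V * C * Vᵀ) * Mᵀ = B := by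
  have hV' : V * Vᵀ = 1 := mul_eq_one_comm.mp hV
  have hM' : M = V * diagonal α * Vᵀ := by
    rw [← hM, Matrix.mul_assoc, hV', Matrix.mul_one]
  have hN' : N = V * diagonal β * Vᵀ := by
    rw [← hN, Matrix.mul_assoc, hV', Matrix.mul_one]
  have hin : diagonal α * C * diagonal β + diagonal β * C * diagonal α = Vᵀ * B * V := by
    ext i j
    rw [← hC i j, Matrix.add_apply, mul_diagonal, diagonal_mul, mul_diagonal, diagonal_mul]
    ring
  have hc : ∀ Z : Matrix m m ℝ, Vᵀ * (V * Z) = Z := fun Z => by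
    rw [← Matrix.mul_assoc, hV, Matrix.one_mul]
  have step : M * (V * C * Vᵀ) * Nᵀ + N * (V * C * Vᵀ) * Mᵀ
      = V * ((diagonal α * C * diagonal β + diagonal β * C * diagonal α) * Vᵀ) := by
    rw [hM', hN']
    simp only [transpose_mul, transpose_transpose, diagonal_transpose, Matrix.mul_assoc, hc,
      Matrix.mul_add, Matrix.add_mul]
  rw [step, hin, Matrix.mul_assoc, hV', Matrix.mul_one, ← Matrix.mul_assoc, hV', Matrix.one_mul]

end Lyapunov

end Literature.Analysis.Convex.SymmetricKroneckerProduct
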